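import Summits.BirchSwinnertonDyer.BirchSwinnertonDyer.Theorems.KimAtThreeDeepUpperOffStratumPortEDeep
import Summits.BirchSwinnertonDyer.BirchSwinnertonDyer.Theorems.KimAtThreeShallowEqDeepSplitGlueNoStub
import HarnessLib

/-!
# Route `KimAtThreeKolyvagin` (rung W2), crux `DeepUpperAtThreeOffKatoStratum` (item 19562), registered
# stub `stub_additiveDefect`: the stub-shaped corollary of the DEEP-keyed free-exponent road — every
# additive-defect row, `E(ℚ₃)[3] ≠ 0` included, from S24-DEEP ×2 + GZK + Poitou–Tate + ONE port family

Cell `bsd-addord`, seat `bsd-addord-w2-acc1` (PROGRAMME PART 1b, ACCEL-LIST l.753 row (1)), item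
`stmt-BirchSwinnertonDyer-19562` (owner w2-c5; `--supports` helpers only).  Sequel of
`KimAtThreeDeepUpperOffStratumPortEDeep` (`deepUpper_conclusion_of_port_e_deep`).  Theorems only (no
definition, no named fact, no `sorry`); nothing asserted about any curve; BSD is not proved by any of this.

* `deepUpper_datum_of_poitouTate_of_port_e_deep` — the row in the crux's currency (`ord(δ̃) = 0`), the
  Poitou–Tate families from the named fact `poitouTate_selmerStructure_duality ℚ`.
* ★ `stub_additiveDefect_of_deepFacts_of_portFamily` — the registered stub `stub_additiveDefect` VERBATIM
  as conclusion ⟸ `hS24d`, `hS24d₂` (S24-DEEP, FLAG `S24-DEEP-PORT@3`), GZK, PT and the port family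
  `HPortDefectDeep` (inline): on every tower-surjective `W` additive at `3`, at every lattice-optimal
  datum `P` at the conductor on a defect row, for every `v₃ ∣ 3` and generator family `η`, SOME `t e : ℕ`
  such that every `τ`-datum canonical for `η` with primes in the class of depth `k + t` carries witnesses
  `KatoKuriharaWitnessAt W k e …` — cell n1011's (B6) convention (the port chooses its own depth shift
  `t`, e.g. `3^t = #E(ℚ₃)[3^∞]`, and exponent `e`, e.g. `e = t` after scaling Kato's family by
  `3^{v₃(c₃)+v₃(c_P)}`): Kim AJM 148 Thm. 3.13 / Kato Thm. 12.5 (1) at an additive `3` with the lattice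
  index of Kim 2026 Rem. 3.8 carried — NOT in print at `3`, the SAME debt class as crux 19560.
* `portEDeep_of_portWith₂` / `deepUpper_optimal_of_deepPortsWith₂` — on the `3 ∤ c₃ ∧ 3 ∤ c_D` rows of
  EVERY local torsion `#E(ℚ₃)[3] = 3^t` the registered `t`-general PORT″ `KatoKuriharaPortThreeAtWith₂ W t`
  IS the deep port at `(t, t)`: the UPPER twin of w2-c2's `deepLower_optimal_of_deepPortsWith` (19679's
  `3 ∤ c₃` rows) — the `E(ℚ₃)[3] ≠ 1` disjunct of the stub at `3 ∤ c₃ ∧ 3 ∤ c_D` modulo a REGISTERED predicate.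
[cite: Kim2025RefinedTNC, Thm 1.1, §5] [cite: Kim2022StructureSelmer, Thm. 1.9 (6), Thm. 3.13, Rem. 3.8, §2.2.2]
[cite: Sakamoto2024, Thm. 4.4 (1)(2) (p. 926)] [cite: MilneADT2006, Ch. I, Thm. 4.10] [cite: Kato2004Asterisque, Thm. 12.5 (1)]
-/

set_option autoImplicit false
-- the Theorems namespace of a single-conjunct summit repeats the summit name by design (D-0017)
set_option linter.dupNamespace false

noncomputable section

open scoped Classical NumberField ContRepresentation
open Function Field NumberField IsDedekindDomain IsDedekindDomain.HeightOneSpectrum WeierstrassCurve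
  CongruenceSubgroup
  Literature.NumberTheory.EllipticCurves Literature.NumberTheory.EllipticCurves.ModularForms
  Literature.NumberTheory.EllipticCurves.Rank1Residual
  Literature.NumberTheory.GaloisRepresentations
  Literature.NumberTheory.GaloisRepresentations.DiscreteGaloisModule Literature.NumberTheory.GaloisCohomology
  Rat.HeightOneSpectrum
  Summit.BirchSwinnertonDyer.Rank1Residual.GaloisImage
  Summit.BirchSwinnertonDyer.Rank1Residual.GaloisImage.Assembly Summit.BirchSwinnertonDyer.Rank1Residual.X4
  Summit.BirchSwinnertonDyer.BirchSwinnertonDyer.Theorems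
  Summit.BirchSwinnertonDyer.BirchSwinnertonDyer.Theorems.KimAtThreeKolyvaginUnitLevelOneRungs
  Summit.BirchSwinnertonDyer.BirchSwinnertonDyer.Theorems.KimAtThreeDeepUpperOffStratumPortEDeep
  Summit.BirchSwinnertonDyer.BirchSwinnertonDyer.Theorems.KimAtThreeShallowEqDeepSplitGlueNoStub
  Summit.BirchSwinnertonDyer.BirchSwinnertonDyer.Theorems.KimAtThreeDeepLowerKatoStratumOfFacts

namespace Summit.BirchSwinnertonDyer.BirchSwinnertonDyer.Theorems.KimAtThreeDeepUpperAdditiveDefectOfPortEDeep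

/-- **The row in the crux's currency from S24-DEEP ×2 + GZK + the Poitou–Tate named fact + ONE deep-keyed
port**, any datum, free `t` and `e`. [cite: Kim2025RefinedTNC, Thm 1.1] [cite: MilneADT2006, Ch. I, Thm. 4.10]
[cite: Kim2022StructureSelmer, §1.4.3–1.4.4 (PDF p. 7), Thm. 3.13] -/
theorem deepUpper_datum_of_poitouTate_of_port_e_deep
    (hS24d : S24Deep.kolyvaginSystems_freeRankOne_zmod_three_pow_deep)
    (hS24d₂ : S24Deep.kolyvaginSystems_idealOfBasis_eq_fittingIdeal_zmod_three_pow_deep)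
    (hGZK : rank_eq_analyticRank_of_analyticRank_le_one)
    (hPT : poitouTate_selmerStructure_duality ℚ)
    (W : WeierstrassCurve ℚ) [W.IsElliptic] [W.IsGloballyMinimal]
    (htower : ∀ m : ℕ, W.HasSurjectiveModNGaloisRep (3 ^ m : ℕ))
    {N : ℕ} [NeZero N] (D : ModularParametrizationData W N)
    (hint : ∀ r : ℚ, ratPlusSymbol D.f r ≠ 0 → 0 ≤ padicValRat 3 (ratPlusSymbol D.f r))
    (hord : kuriharaVanishingOrder W 3 D.f = 0)
    (v₃ : HeightOneSpectrum (𝓞 ℚ)) (hv₃ : ((3 : ℕ) : 𝓞 ℚ) ∈ v₃.asIdeal)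
    (η : (q : HeightOneSpectrum (𝓞 ℚ)) → (ZMod (Ideal.absNorm q.asIdeal))ˣ)
    (hη : ∀ q : HeightOneSpectrum (𝓞 ℚ), Subgroup.zpowers (η q) = ⊤)
    (t e : ℕ)
    (hPort : ∀ (k : ℕ)
      (Dk : KolyvaginDatum (W.torsionGaloisModule (((3 : ℕ) : ℤ) ^ k * ((3 : ℕ) : ℤ)))),
      Dk.IsCanonicalTauDatumThreeAtWith W (k + t) k η →
      ∃ (κ : Finset (HeightOneSpectrum (𝓞 ℚ)) →
            galoisCohomology (W.torsionGaloisModule (((3 : ℕ) : ℤ) ^ k * ((3 : ℕ) : ℤ))) 1)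
        (Λ : galoisCohomology ((W.torsionGaloisModule (((3 : ℕ) : ℤ) ^ k * ((3 : ℕ) : ℤ))).toLocal
            (Sum.inr v₃)) 1 →+ ZMod (3 ^ (k + 1)))
        (κ' : Finset (HeightOneSpectrum (𝓞 ℚ)) →
            galoisCohomology (W.torsionGaloisModule (((3 : ℕ) : ℤ) ^ k * ((3 : ℕ) : ℤ))) 1),
        KatoKuriharaWitnessAt W k e Dk v₃ D κ Λ κ') :
    ∃ dd : ℕ, kuriharaPartialDeepInfty W 3 D.f = dd ∧
      ((padicValNat 3 (Nat.card (AddCommGroup.primaryComponent W.sha 3)) + dd : ℕ) : ℕ∞) ≤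
        kuriharaPartial W 3 D.f 0 := by
  haveI : Fact (Nat.Prime 3) := ⟨Nat.prime_three⟩
  have h0 : ratPlusSymbol D.f 0 ≠ 0 :=
    ratPlusSymbol_zero_ne_zero_of_kuriharaVanishingOrder_eq_zero W 3 D.f hord
  have hL : W.entireLFunction 1 ≠ 0 :=
    D.isNewformOf.entireLFunction_one_ne_zero_of_ratPlusSymbol_zero_ne_zero h0
  obtain ⟨inv, hperf, hsum, -, hcompl⟩ := hPT 3
  obtain ⟨inv', hperf', hsum', hcompl', hinj'⟩ := exists_localInvariants_three_pow_of_poitouTate hPT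
  exact deepUpper_conclusion_of_port_e_deep hS24d hS24d₂ hGZK W htower hL D hint inv hperf hsum hcompl
    inv' hperf' hsum' hcompl' hinj' v₃ hv₃ η hη t e hPort

/-- ★ **The registered stub `stub_additiveDefect` of crux 19562 VERBATIM as conclusion, from S24-DEEP ×2,
GZK, Poitou–Tate and the DEEP-keyed port family on the stub's rows** (antecedents inside
`HPortDefectDeep`: the tower, `Addv W 3`, the datum lattice-optimal at the conductor, the defect
disjunction `3 ∣ c₃ ∨ #E(ℚ₃)[3] ≠ 1 ∨ 3 ∣ c_P`; the port CHOOSES its depth shift `t` and exponent `e` —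
n1011's (B6) convention, honest on every row incl. `E(ℚ₃)[3] ≠ 0`).  The owner's assembly reads
`DeepUpperAtThreeOffKatoStratum_of stub_nonAdditive (stub_additiveDefect_of_deepFacts_of_portFamily …)`.
[cite: Kim2025RefinedTNC, Thm 1.1] [cite: Kim2022StructureSelmer, Thm. 3.13, Rem. 3.8 and §2.2.2]
[cite: Sakamoto2024, Thm. 4.4 (1)(2) (p. 926)] [cite: MilneADT2006, Ch. I, Thm. 4.10] -/
theorem stub_additiveDefect_of_deepFacts_of_portFamily
    (hS24d : S24Deep.kolyvaginSystems_freeRankOne_zmod_three_pow_deep)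
    (hS24d₂ : S24Deep.kolyvaginSystems_idealOfBasis_eq_fittingIdeal_zmod_three_pow_deep)
    (hGZK : rank_eq_analyticRank_of_analyticRank_le_one)
    (hPT : poitouTate_selmerStructure_duality ℚ)
    (HPortDefectDeep : ∀ (W : WeierstrassCurve ℚ) [W.IsElliptic] [W.IsGloballyMinimal],
      (∀ m : ℕ, W.HasSurjectiveModNGaloisRep (3 ^ m : ℕ)) →
      (haveI : Fact (Nat.Prime 3) := ⟨Nat.prime_three⟩; Addv W 3) →
      ∀ (v₃ : HeightOneSpectrum (𝓞 ℚ)), ((3 : ℕ) : 𝓞 ℚ) ∈ v₃.asIdeal →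
      ∀ (η : (q : HeightOneSpectrum (𝓞 ℚ)) → (ZMod (Ideal.absNorm q.asIdeal))ˣ),
        (∀ q, Subgroup.zpowers (η q) = ⊤) →
      ∀ {N : ℕ} [NeZero N] (P : ModularParametrizationData W N), N = W.conductorNorm ℤ →
        (∀ z ∈ P.L.lattice, ∃ w ∈ periodLattice P.f, z = P.c * w) →
        (3 ∣ (W.baseChange ℚ_[3]).localTamagawaNumber ℤ_[3] ∨
          Nat.card {Q : (W.baseChange ℚ_[3]).toAffine.Point // (3 : ℕ) • Q = 0} ≠ 1 ∨
          (3 : ℤ) ∣ P.maninConstant) →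
        ∃ t e : ℕ, ∀ (k : ℕ)
          (Dk : KolyvaginDatum (W.torsionGaloisModule (((3 : ℕ) : ℤ) ^ k * ((3 : ℕ) : ℤ)))),
          Dk.IsCanonicalTauDatumThreeAtWith W (k + t) k η →
          ∃ (κ : Finset (HeightOneSpectrum (𝓞 ℚ)) →
                galoisCohomology (W.torsionGaloisModule (((3 : ℕ) : ℤ) ^ k * ((3 : ℕ) : ℤ))) 1)
            (Λ : galoisCohomology ((W.torsionGaloisModule (((3 : ℕ) : ℤ) ^ k * ((3 : ℕ) : ℤ))).toLocal
                (Sum.inr v₃)) 1 →+ ZMod (3 ^ (k + 1)))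
            (κ' : Finset (HeightOneSpectrum (𝓞 ℚ)) →
                galoisCohomology (W.torsionGaloisModule (((3 : ℕ) : ℤ) ^ k * ((3 : ℕ) : ℤ))) 1),
            KatoKuriharaWitnessAt W k e Dk v₃ P κ Λ κ') :
    ∀ (W₀ : WeierstrassCurve ℚ) [W₀.IsElliptic] [W₀.IsGloballyMinimal],
      (∀ n : ℕ, W₀.HasSurjectiveModNGaloisRep (3 ^ n : ℕ)) → Finite W₀.sha →
      ∀ {N : ℕ} [NeZero N], N = W₀.conductorNorm ℤ →
      ∀ (D₀ : Literature.NumberTheory.EllipticCurves.ModularForms.ModularParametrizationData W₀ N),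
        (∀ z ∈ D₀.L.lattice, ∃ w ∈ Literature.NumberTheory.EllipticCurves.ModularForms.periodLattice D₀.f, z = D₀.c * w) →
        (∀ (W₂ : WeierstrassCurve ℚ) [W₂.IsElliptic]
          (D₂ : Literature.NumberTheory.EllipticCurves.ModularForms.ModularParametrizationData W₂ N),
          D₂.f = D₀.f → D₀.modularDegree ≤ D₂.modularDegree) →
        (∀ r : ℚ, Literature.NumberTheory.EllipticCurves.ratPlusSymbol D₀.f r ≠ 0 →
          0 ≤ padicValRat 3 (Literature.NumberTheory.EllipticCurves.ratPlusSymbol D₀.f r)) →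
        Literature.NumberTheory.EllipticCurves.kuriharaVanishingOrder W₀ 3 D₀.f = 0 →
        (haveI : Fact (Nat.Prime 3) := ⟨Nat.prime_three⟩;
            Literature.NumberTheory.EllipticCurves.Rank1Residual.Addv W₀ 3) →
        (3 ∣ (W₀.baseChange ℚ_[3]).localTamagawaNumber ℤ_[3] ∨
          Nat.card {Q : (W₀.baseChange ℚ_[3]).toAffine.Point // (3 : ℕ) • Q = 0} ≠ 1 ∨
          (3 : ℤ) ∣ D₀.maninConstant) →
        ∃ d : ℕ, Literature.NumberTheory.EllipticCurves.kuriharaPartialDeepInfty W₀ 3 D₀.f = d ∧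
          ((padicValNat 3 (Nat.card (AddCommGroup.primaryComponent W₀.sha 3)) + d : ℕ) : ℕ∞) ≤
            Literature.NumberTheory.EllipticCurves.kuriharaPartial W₀ 3 D₀.f 0 := by
  intro W₀ _ _ htow _ N _ hN D₀ hopt _ hint hord hA hdef
  obtain ⟨v₃, η, hv₃, hη⟩ := exists_place_three_and_generators
  obtain ⟨t, e, hPort⟩ := HPortDefectDeep W₀ htow hA v₃ hv₃ η hη D₀ hN hopt hdef
  exact deepUpper_datum_of_poitouTate_of_port_e_deep hS24d hS24d₂ hGZK hPT W₀ htow D₀ hint hord v₃ hv₃ η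
    hη t e hPort

/-! ## The `3 ∤ c₃ ∧ 3 ∤ c_P` rows of EVERY local torsion `#E(ℚ₃)[3] = 3^t`: PORT″ at `t` ⟹ the deep port -/

/-- **PORT″ at `t` ⟹ the deep-keyed free-exponent port at `(t, e) = (t, t)`.**  For `W` ADDITIVE at `3`
with `3 ∤ c₃`, `ρ̄_{E,3}` onto, `#E(ℚ₃)[3] = 3^t`, `v₃ ∣ 3`, a datum `P` with `3 ∤ c_P` and the unit period
transfer, n1011's registered PORT″ `KatoKuriharaPortThreeAtWith₂ W t v₃ η P` (the `t`-general predicate;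
crux 19560 is its `t = 0` instance) yields witnesses `KatoKuriharaWitnessAt W k t …` at every DEEP-guarded
`η`-canonical datum (`Dk.IsCanonicalTauDatumThreeAtWith W (k + t) k η`) — call PORT″ at `k = k′` with the
pinned reduction, keep the depth-`k` witness. [cite: Kim2022StructureSelmer, Thm. 3.13 and §2.2.2]
[cite: Kato2004Asterisque, Thm. 12.5 (1)] -/
theorem portEDeep_of_portWith₂
    (W : WeierstrassCurve ℚ) [W.IsElliptic] [W.IsGloballyMinimal] (t : ℕ)
    (hadd : haveI : Fact (Nat.Prime 3) := ⟨Nat.prime_three⟩; Addv W 3)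
    (hc3 : ¬ 3 ∣ (W.baseChange ℚ_[3]).localTamagawaNumber ℤ_[3])
    (hsurj : W.HasSurjectiveModNGaloisRep ((3 : ℕ) : ℤ))
    (ht : Nat.card {Q : (W.baseChange ℚ_[3]).toAffine.Point // (3 : ℕ) • Q = 0} = 3 ^ t)
    {N : ℕ} [NeZero N] (P : ModularParametrizationData W N) (hcP : ¬ (3 : ℤ) ∣ P.maninConstant)
    (hper : ∃ u : ℚ, ‖(u : ℚ_[3])‖ = 1 ∧ W.realPeriodRat = u * plusPeriod P.f)
    (v₃ : HeightOneSpectrum (𝓞 ℚ)) (hv₃ : ((3 : ℕ) : 𝓞 ℚ) ∈ v₃.asIdeal)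
    (η : (q : HeightOneSpectrum (𝓞 ℚ)) → (ZMod (Ideal.absNorm q.asIdeal))ˣ)
    (hPort : KatoKuriharaPortThreeAtWith₂ W t v₃ η P) :
    ∀ (k : ℕ) (Dk : KolyvaginDatum (W.torsionGaloisModule (((3 : ℕ) : ℤ) ^ k * ((3 : ℕ) : ℤ)))),
      Dk.IsCanonicalTauDatumThreeAtWith W (k + t) k η →
      ∃ (κ : Finset (HeightOneSpectrum (𝓞 ℚ)) →
            galoisCohomology (W.torsionGaloisModule (((3 : ℕ) : ℤ) ^ k * ((3 : ℕ) : ℤ))) 1)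
        (Λ : galoisCohomology ((W.torsionGaloisModule (((3 : ℕ) : ℤ) ^ k * ((3 : ℕ) : ℤ))).toLocal
            (Sum.inr v₃)) 1 →+ ZMod (3 ^ (k + 1)))
        (κ' : Finset (HeightOneSpectrum (𝓞 ℚ)) →
            galoisCohomology (W.torsionGaloisModule (((3 : ℕ) : ℤ) ^ k * ((3 : ℕ) : ℤ))) 1),
        KatoKuriharaWitnessAt W k t Dk v₃ P κ Λ κ' := by
  haveI : Fact (Nat.Prime 3) := ⟨Nat.prime_three⟩
  intro k Dk hDk
  have hcP' : ¬ ((3 : ℕ) : ℤ) ∣ P.maninConstant := by exact_mod_cast hcP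
  obtain ⟨red, hred⟩ := exists_torsionReduction_three W k k
  obtain ⟨κ, Λ, κ', -, -, -, hW, -, -⟩ :=
    hPort k k Dk Dk red hDk hDk le_rfl hred hadd hc3 hsurj ht hv₃ hcP' hper
  exact ⟨κ, Λ, κ', hW⟩

/-- **The UPPER twin of w2-c2's `deepLower_optimal_of_deepPortsWith`: crux 19076 / 19562's conclusion
for EVERY `t` on the `3 ∤ c₃` stratum, GRANTED PORT″ at `t`.**  Row: `W/ℚ` globally minimal, ADDITIVE at
`3` with `3 ∤ c₃`, the `3`-adic tower onto, `#E(ℚ₃)[3] = 3^t`, an OPTIMAL datum `D` (lattice-optimal;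
any level) with `3 ∤ c_D` — so for `t ≥ 1` exactly the `E(ℚ₃)[3] ≠ 1` rows of `stub_additiveDefect` with
`3 ∤ c₃ ∧ 3 ∤ c_D` — `3`-integral plus symbols, `ord(δ̃) = 0`; GRANTED `hS24d`/`hS24d₂` (S24-DEEP), GZK,
PT and `KatoKuriharaPortThreeAtWith₂ W t v₃ η D` (a registered predicate, FLAG `K22-Thm3.13-PORT@3`):
`∃ d, ∂^{(∞)}_deep(δ̃) = d ∧ ord₃ #Ш(E/ℚ)(3) + d ≤ ∂⁽⁰⁾(δ̃)` for `f = D.f` (period transfer by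
`X4.periodTransfer_of_optimal`). [cite: Kim2025RefinedTNC, Thm 1.1] [cite: Kim2022StructureSelmer, Thm. 3.13]
[cite: Sakamoto2024, Thm. 4.4 (1)(2) (p. 926)] [cite: CremonaAlgorithms1997, §2.8 (p. 26)] -/
theorem deepUpper_optimal_of_deepPortsWith₂
    (hS24d : S24Deep.kolyvaginSystems_freeRankOne_zmod_three_pow_deep)
    (hS24d₂ : S24Deep.kolyvaginSystems_idealOfBasis_eq_fittingIdeal_zmod_three_pow_deep)
    (hGZK : rank_eq_analyticRank_of_analyticRank_le_one)
    (hPT : poitouTate_selmerStructure_duality ℚ)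
    (W : WeierstrassCurve ℚ) [W.IsElliptic] [W.IsGloballyMinimal] (t : ℕ)
    (hadd : haveI : Fact (Nat.Prime 3) := ⟨Nat.prime_three⟩; Addv W 3)
    (hc3 : ¬ 3 ∣ (W.baseChange ℚ_[3]).localTamagawaNumber ℤ_[3])
    (htower : ∀ m : ℕ, W.HasSurjectiveModNGaloisRep (3 ^ m : ℕ))
    (ht : Nat.card {Q : (W.baseChange ℚ_[3]).toAffine.Point // (3 : ℕ) • Q = 0} = 3 ^ t)
    {N : ℕ} [NeZero N] (D : ModularParametrizationData W N)
    (hopt : ∀ z ∈ D.L.lattice, ∃ w ∈ periodLattice D.f, z = D.c * w)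
    (hcD : ¬ (3 : ℤ) ∣ D.maninConstant)
    (hint : ∀ r : ℚ, ratPlusSymbol D.f r ≠ 0 → 0 ≤ padicValRat 3 (ratPlusSymbol D.f r))
    (hord : kuriharaVanishingOrder W 3 D.f = 0)
    (v₃ : HeightOneSpectrum (𝓞 ℚ)) (hv₃ : ((3 : ℕ) : 𝓞 ℚ) ∈ v₃.asIdeal)
    (η : (q : HeightOneSpectrum (𝓞 ℚ)) → (ZMod (Ideal.absNorm q.asIdeal))ˣ)
    (hη : ∀ q : HeightOneSpectrum (𝓞 ℚ), Subgroup.zpowers (η q) = ⊤)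
    (hPort : KatoKuriharaPortThreeAtWith₂ W t v₃ η D) :
    ∃ dd : ℕ, kuriharaPartialDeepInfty W 3 D.f = dd ∧
      ((padicValNat 3 (Nat.card (AddCommGroup.primaryComponent W.sha 3)) + dd : ℕ) : ℕ∞) ≤
        kuriharaPartial W 3 D.f 0 := by
  haveI : Fact (Nat.Prime 3) := ⟨Nat.prime_three⟩
  have hsurj : W.HasSurjectiveModNGaloisRep ((3 : ℕ) : ℤ) := by simpa using htower 1
  exact deepUpper_datum_of_poitouTate_of_port_e_deep hS24d hS24d₂ hGZK hPT W htower D hint hord v₃ hv₃ η hη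
    t t (portEDeep_of_portWith₂ W t hadd hc3 hsurj ht D hcD (periodTransfer_of_optimal 3 D hopt hcD) v₃
      hv₃ η hPort)

end Summit.BirchSwinnertonDyer.BirchSwinnertonDyer.Theorems.KimAtThreeDeepUpperAdditiveDefectOfPortEDeep

end
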